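import Summits.NavierStokesRegularity.NavierStokesRegularity.Theses.SubcubicESS
import Summits.NavierStokesRegularity.NavierStokesRegularity.Theorems.SubcubicESSVelocityRescale
import Literature.Analysis.FluidPDE.TaoLocalisationHolds
import Literature.Analysis.FluidPDE.TaoLocalisationProofs

/-!
# Route SubcubicESS — `EnergyBridge` (item stmt-NavierStokesRegularity-10675)

The bridge of the route `SubcubicESS` (card `subcubic-ess-bridge`): a **sub-cubic** uniform
velocity bound in Tao's class,

  `|u(t, x)| ≤ F(A) t^{-1/2}` for `ν = 1`, `sup_{[0,T]} ‖u(t)‖₃ ≤ A`, `A ≥ 2`, with `F(A) = o(A³)`,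

implies that every classical solution of the unforced Navier–Stokes system with viscosity `ν > 0`
on `ℝ³ × [0, T)` which is Leray–Hopf from its rapidly decaying datum has
`⨆_{0 ≤ t < T} ‖u(t)‖_{L³} < ⊤`.

## Proof (one Hölder line against the energy)

Put `t₀ = T/2`, `e₀ = 2E(u₀)` (so `∫ |u(t)|² ≤ e₀`, Leray's energy inequality), and let `N₀` bound
`‖u(t)‖₃` on `[0, t₀]`. For `T' ∈ [t₀, T)`:

* on the closed slab `[0, T']` the solution has all Sobolev norms bounded (Tao 2013, Cor. 11.1 +
  Thm. 5.4, `tao2011_hasBoundedSobolevNormsOn_holds`), hence is bounded (Sobolev imbedding,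
  `linfty_bound_of_hasBoundedSobolevNormsOn_holds`) and `N' := sup_{[0,T']} ‖u(t)‖₃ < ∞`
  (`‖u‖₃³ ≤ ‖u‖_∞ ‖u‖₂²`);
* the rescaled pair `w(s, x) = ν⁻¹u(s/ν, x)` (Tao 2013, footnote 3) is in Tao's class on `[0, νT']`
  with `‖w(s)‖₃ ≤ A := max(2, ν⁻¹N')`, so the velocity clause gives
  `|u(t, x)| ≤ ν F(A) (νt)^{-1/2} ≤ ν F(A) (νt₀)^{-1/2}` on `[t₀, T']`;
* `‖u(t)‖₃³ ≤ ‖u(t)‖_∞ ‖u(t)‖₂² ≤ ν F(A) (νt₀)^{-1/2} e₀` on `[t₀, T']`, whence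
  `N' ≤ max(N₀, b)` with `b³ = ν F(A) (νt₀)^{-1/2} e₀`;
* if `N' > max(2ν, νA₀, N₀)` (with `A₀` from the `o(A³)` clause at `ε = 1/(2(K+1))`,
  `K = ν (νt₀)^{-1/2} e₀ ν⁻³`), then `A = ν⁻¹N' ≥ A₀` and
  `N'³ ≤ b³ ≤ ν (νt₀)^{-1/2} e₀ · ε A³ = εK N'³ ≤ N'³/2`, absurd since `N' > 0`.

So `‖u(t)‖₃ ≤ max(2ν, νA₀, N₀)` for all `t < T`.

## Tree search

Reused: `subcubicESS_norm_le_of_velocity_bound` (`Theorems/SubcubicESSVelocityRescale.lean`, the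
route's copy of `norm_le_of_tao_quantitative` with `taoTripleExp C ↦ F`: the velocity clause at
viscosity `ν` by Tao's rescaling `IsClassicalNSSolutionOn.viscosityRescale_zero`),
`tao2011_hasBoundedSobolevNormsOn_holds`, `linfty_bound_of_hasBoundedSobolevNormsOn_holds`,
`IsLerayHopfOn.lintegral_enorm_sq_le` (`TaoLocalisation*`). Mathlib:
`eLpNorm_nnreal_pow_eq_lintegral`, `ENNReal.pow_le_pow_left_iff`, `Real.rpow_inv_natCast_pow`,
`Real.rpow_le_rpow_of_nonpos`.

## References

* T. Tao, *Quantitative bounds for critically bounded solutions to the Navier–Stokes equations*,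
  arXiv:1908.04958, Thm. 1.2 (the shape of the velocity clause). [Tao2021QuantitativeNS]
* T. Tao, Anal. PDE 6 (2013) = arXiv:1108.1165, footnote 3 (viscosity rescaling), Cor. 11.1.
* G. Seregin, Comm. Math. Phys. 312 (2012), 833–845 (the `L³` criterion this feeds). [Seregin2012]
-/

noncomputable section

open Literature.Analysis.FluidPDE MeasureTheory Set Function Filter Topology
open scoped ENNReal NNReal

namespace Summit.NavierStokesRegularity.NavierStokesRegularity.Theorems

/-! ### Step 0: an `L³` bound from a pointwise bound and the energy -/

/-- **Hölder against the energy**, `‖f‖₃³ ≤ ‖f‖_∞ ‖f‖₂²`, in the root-free form used below: if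
`|f| ≤ M` pointwise (`M ≥ 0`), `∫ |f|² ≤ e` and `M e ≤ b³` with `b ≥ 0`, then `‖f‖_{L³} ≤ b`.
Proof: `∫ |f|³ ≤ M ∫ |f|² ≤ M e ≤ b³` and `‖f‖₃³ = ∫ |f|³`. [folklore] -/
theorem subcubicESS_eLpNorm_three_le_ofReal {α : Type*} [MeasurableSpace α] {μ : Measure α}
    {G : Type*} [NormedAddCommGroup G] {f : α → G} {M e b : ℝ} (hM0 : 0 ≤ M)
    (hM : ∀ x, ‖f x‖ ≤ M) (he : ∫⁻ x, ‖f x‖ₑ ^ 2 ∂μ ≤ ENNReal.ofReal e) (hb : 0 ≤ b)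
    (hle : M * e ≤ b ^ 3) : eLpNorm f 3 μ ≤ ENNReal.ofReal b := by
  have h3 := eLpNorm_nnreal_pow_eq_lintegral (f := f) (μ := μ) (p := (3 : ℝ≥0)) three_ne_zero
  simp only [ENNReal.coe_ofNat, NNReal.coe_ofNat, ENNReal.rpow_ofNat] at h3
  have hpt : ∀ x, ‖f x‖ₑ ^ 3 ≤ ENNReal.ofReal M * ‖f x‖ₑ ^ 2 := fun x => by
    have h' : ‖f x‖ₑ ^ 3 = ‖f x‖ₑ * ‖f x‖ₑ ^ 2 := by ring
    rw [h']
    gcongr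
    rw [← ofReal_norm]
    exact ENNReal.ofReal_le_ofReal (hM x)
  have hint : ∫⁻ x, ‖f x‖ₑ ^ 3 ∂μ ≤ ENNReal.ofReal b ^ 3 :=
    calc ∫⁻ x, ‖f x‖ₑ ^ 3 ∂μ ≤ ∫⁻ x, ENNReal.ofReal M * ‖f x‖ₑ ^ 2 ∂μ := lintegral_mono hpt
      _ = ENNReal.ofReal M * ∫⁻ x, ‖f x‖ₑ ^ 2 ∂μ :=
          lintegral_const_mul' _ _ ENNReal.ofReal_ne_top
      _ ≤ ENNReal.ofReal M * ENNReal.ofReal e := by gcongr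
      _ = ENNReal.ofReal (M * e) := (ENNReal.ofReal_mul hM0).symm
      _ ≤ ENNReal.ofReal (b ^ 3) := ENNReal.ofReal_le_ofReal hle
      _ = ENNReal.ofReal b ^ 3 := ENNReal.ofReal_pow hb 3
  rw [← h3] at hint
  exact (ENNReal.pow_le_pow_left_iff three_ne_zero).1 hint

/-! ### Step 1: closed sub-slabs
(the velocity clause at viscosity `ν` is `Theorems/SubcubicESSVelocityRescale.lean`) -/

/-- **Closed sub-slabs.** For a classical unforced solution on `[0, T)` with viscosity `ν > 0`,
Leray–Hopf from its rapidly decaying datum, and `0 < T' < T`: the solution is classical on the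
closed slab `[0, T']`, has all Sobolev norms bounded there (Tao 2013, Cor. 11.1 + Cor. 4.3 +
Thm. 5.4 (iv), `tao2011_hasBoundedSobolevNormsOn_holds`; finite energy from the Leray–Hopf energy
inequality), and is bounded on `[0, T'] × ℝ³` (Sobolev imbedding,
`linfty_bound_of_hasBoundedSobolevNormsOn_holds`). [cite: Tao2011, Cor. 11.1 + Cor. 4.3 + Thm. 5.4 (iv)] -/
theorem subcubicESS_closedSlab {ν T T' : ℝ} (hν : 0 < ν) (hT'0 : 0 < T') (hT'T : T' < T)
    {u : ℝ → EuclideanSpace ℝ (Fin 3) → EuclideanSpace ℝ (Fin 3)}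
    {p : ℝ → EuclideanSpace ℝ (Fin 3) → ℝ} (hsol : IsClassicalNSSolutionOn (Ico 0 T) ν 0 u p)
    (hLH : IsLerayHopfOn T ν 0 (u 0) u) (h₀ : HasRapidSpatialDecay (u 0)) :
    IsClassicalNSSolutionOn (Icc 0 T') ν 0 u p ∧ HasBoundedSobolevNormsOn (Icc 0 T') u ∧
      ∃ C : ℝ, ∀ t ∈ Icc 0 T', ∀ x, ‖u t x‖ ≤ C := by
  have hsol' : IsClassicalNSSolutionOn (Icc 0 T') ν 0 u p :=
    hsol.mono (Icc_subset_Ico_right hT'T) (uniqueDiffOn_Icc hT'0)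
  have hE : ∃ C : ℝ≥0, ∀ t ∈ Icc 0 T', ∫⁻ x, ‖u t x‖ₑ ^ 2 ≤ C := by
    refine ⟨(ENNReal.ofReal (2 * VectorCalculus.kineticEnergy (u 0))).toNNReal, fun t ht => ?_⟩
    rw [ENNReal.coe_toNNReal ENNReal.ofReal_ne_top]
    exact hLH.lintegral_enorm_sq_le hν.le ⟨ht.1, ht.2.trans hT'T.le⟩
  have hHk : HasBoundedSobolevNormsOn (Icc 0 T') u :=
    tao2011_hasBoundedSobolevNormsOn_holds hν hT'0 hsol' hE h₀
  have hC2 : ∀ t ∈ Icc 0 T', ContDiff ℝ 2 (u t) := fun t ht =>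
    (hsol'.contDiff_velocity ht).of_le (by norm_cast)
  exact ⟨hsol', hHk, linfty_bound_of_hasBoundedSobolevNormsOn_holds hC2 hHk⟩

/-- **`L³` bound on closed sub-slabs.** In the situation of `subcubicESS_closedSlab`, the `L³`
norms `‖u(t)‖₃`, `t ∈ [0, T']`, are bounded by a real number (`‖u‖₃³ ≤ ‖u‖_∞ ‖u‖₂²` with the
uniform bound and the energy inequality). [folklore] -/
theorem subcubicESS_eLpNorm_three_le_of_closedSlab {ν T T' : ℝ} (hν : 0 < ν) (hT'0 : 0 < T')
    (hT'T : T' < T) {u : ℝ → EuclideanSpace ℝ (Fin 3) → EuclideanSpace ℝ (Fin 3)}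
    {p : ℝ → EuclideanSpace ℝ (Fin 3) → ℝ}
    (hsol : IsClassicalNSSolutionOn (Ico 0 T) ν 0 u p) (hLH : IsLerayHopfOn T ν 0 (u 0) u)
    (h₀ : HasRapidSpatialDecay (u 0)) :
    ∃ R : ℝ, 0 ≤ R ∧ ∀ t ∈ Icc 0 T', eLpNorm (u t) 3 volume ≤ ENNReal.ofReal R := by
  obtain ⟨-, -, C, hC⟩ := subcubicESS_closedSlab hν hT'0 hT'T hsol hLH h₀
  have hC0 : 0 ≤ C := (norm_nonneg _).trans (hC 0 ⟨le_rfl, hT'0.le⟩ 0)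
  have h1 : 1 ≤ max 1 (C * (2 * VectorCalculus.kineticEnergy (u 0))) := le_max_left _ _
  refine ⟨max 1 (C * (2 * VectorCalculus.kineticEnergy (u 0))), zero_le_one.trans h1,
    fun t ht => ?_⟩
  refine subcubicESS_eLpNorm_three_le_ofReal hC0 (hC t ht)
    (hLH.lintegral_enorm_sq_le hν.le ⟨ht.1, ht.2.trans hT'T.le⟩) (zero_le_one.trans h1) ?_
  calc C * (2 * VectorCalculus.kineticEnergy (u 0))
      ≤ max 1 (C * (2 * VectorCalculus.kineticEnergy (u 0))) := le_max_right _ _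
    _ = max 1 (C * (2 * VectorCalculus.kineticEnergy (u 0))) ^ 1 := (pow_one _).symm
    _ ≤ max 1 (C * (2 * VectorCalculus.kineticEnergy (u 0))) ^ 3 :=
        pow_le_pow_right₀ h1 (by norm_num)

/-! ### The bridge -/

/-- **`EnergyBridge` (item stmt-NavierStokesRegularity-10675 of route SubcubicESS).** A sub-cubic
uniform velocity bound in Tao's class (`|u(t, x)| ≤ F(A) t^{-1/2}` whenever
`sup_{[0,T]} ‖u(t)‖₃ ≤ A`, `A ≥ 2`, `ν = 1`, with `F(A) = o(A³)`) implies that every classical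
solution of the unforced Navier–Stokes system with viscosity `ν > 0` on `ℝ³ × [0, T)`, Leray–Hopf
from its rapidly decaying datum, has `⨆_{t < T} ‖u(t)‖₃ < ⊤`. Proof: the Hölder line
`‖u‖₃³ ≤ ‖u‖_∞ ‖u‖₂² ≤ 2E(u₀) ‖u‖_∞` against the energy (module docstring): with
`N' = sup_{[0,T']} ‖u‖₃` and `A = max(2, ν⁻¹N')`, the velocity clause at viscosity `ν`
(`subcubicESS_norm_le_of_velocity_bound`) gives `N'³ ≤ max(N₀³, ν(νt₀)^{-1/2} 2E(u₀) F(A))`, and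
`F(A) ≤ εA³` with `ε = 1/(2(K+1))` forces `N' ≤ max(2ν, νA₀, N₀)` uniformly in `T' < T`.
[folklore] -/
theorem subcubicESS_energyBridge_proof :
    Summit.NavierStokesRegularity.NavierStokesRegularity.Theses.SubcubicESS.EnergyBridge := by
  intro hX ν T hν hT u p hsol hLH h₀
  obtain ⟨F, hF, hvel⟩ := hX
  -- the energy bound `∫ |u(t)|² ≤ e₀`
  set e₀ : ℝ := 2 * VectorCalculus.kineticEnergy (u 0) with he₀
  have he₀0 : 0 ≤ e₀ := mul_nonneg zero_le_two (kineticEnergy_nonneg _)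
  have hener : ∀ t ∈ Ico 0 T, ∫⁻ x, ‖u t x‖ₑ ^ 2 ≤ ENNReal.ofReal e₀ := fun t ht =>
    hLH.lintegral_enorm_sq_le hν.le ⟨ht.1, ht.2.le⟩
  -- `t₀ = T/2` and the bound `N₀` on `[0, t₀]`
  set t₀ : ℝ := T / 2 with ht₀
  have ht₀0 : 0 < t₀ := by positivity
  have ht₀T : t₀ < T := by rw [ht₀]; linarith
  obtain ⟨N₀, hN₀0, hN₀⟩ := subcubicESS_eLpNorm_three_le_of_closedSlab hν ht₀0 ht₀T hsol hLH h₀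
  -- the constants
  set c : ℝ := (ν * t₀) ^ (-(1 / 2 : ℝ)) with hc
  have hc0 : 0 < c := Real.rpow_pos_of_pos (by positivity) _
  set K : ℝ := ν * c * e₀ * ν⁻¹ ^ 3 with hK
  have hK0 : 0 ≤ K := by positivity
  obtain ⟨A₀, hA₀⟩ := hF (1 / (2 * (K + 1))) (by positivity)
  set B : ℝ := max (2 * ν) (max (ν * A₀) N₀) with hB
  -- ### the key estimate: `‖u(t)‖₃ ≤ B` on every closed slab `[0, T']`, `t₀ ≤ T' < T`
  have hkey : ∀ T', t₀ ≤ T' → T' < T →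
      ∀ t ∈ Icc 0 T', eLpNorm (u t) 3 volume ≤ ENNReal.ofReal B := by
    intro T' hT'1 hT'2
    have hT'0 : 0 < T' := ht₀0.trans_le hT'1
    obtain ⟨hsol', hHk', -⟩ := subcubicESS_closedSlab hν hT'0 hT'2 hsol hLH h₀
    obtain ⟨R, hR0, hR⟩ := subcubicESS_eLpNorm_three_le_of_closedSlab hν hT'0 hT'2 hsol hLH h₀
    -- the finite supremum `N'` of `‖u(t)‖₃` over `[0, T']`
    set S' : ℝ≥0∞ := ⨆ t ∈ Icc 0 T', eLpNorm (u t) 3 volume with hS'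
    have hS'le : S' ≤ ENNReal.ofReal R := iSup₂_le hR
    have hS'fin : S' ≠ ⊤ := (hS'le.trans_lt ENNReal.ofReal_lt_top).ne
    set N' : ℝ := S'.toReal with hN'
    have hN'0 : 0 ≤ N' := ENNReal.toReal_nonneg
    have hN'le : ∀ t ∈ Icc 0 T', eLpNorm (u t) 3 volume ≤ ENNReal.ofReal N' := by
      intro t ht
      rw [hN', ENNReal.ofReal_toReal hS'fin]
      exact le_iSup₂ (f := fun t (_ : t ∈ Icc (0 : ℝ) T') => eLpNorm (u t) 3 volume) t ht
    suffices hNB : N' ≤ B from fun t ht => (hN'le t ht).trans (ENNReal.ofReal_le_ofReal hNB)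
    -- the velocity clause at viscosity `ν` on `[0, T']`, with `A = max 2 (ν⁻¹ N')`
    set A : ℝ := max 2 (ν⁻¹ * N') with hA
    have hvelA := subcubicESS_norm_le_of_velocity_bound hvel hν hT'0 hsol' hHk' hN'le
    -- `F A ≥ 0`
    have hFA : 0 ≤ F A := by
      have h1 := hvelA T' ⟨hT'0, le_rfl⟩ 0
      have h2 : 0 ≤ ν * F A * (ν * T') ^ (-(1 / 2 : ℝ)) := (norm_nonneg _).trans h1
      have h3 : 0 < (ν * T') ^ (-(1 / 2 : ℝ)) := Real.rpow_pos_of_pos (by positivity) _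
      have h4 : 0 ≤ ν * F A := le_of_mul_le_mul_right (by simpa using h2) h3
      exact (mul_nonneg_iff_of_pos_left hν).1 h4
    -- uniform bound on `[t₀, T'] × ℝ³`
    have hMb : ∀ t ∈ Icc t₀ T', ∀ x, ‖u t x‖ ≤ ν * F A * c := by
      intro t ht x
      have ht0 : 0 < t := ht₀0.trans_le ht.1
      refine (hvelA t ⟨ht0, ht.2⟩ x).trans ?_
      have hmono : (ν * t) ^ (-(1 / 2 : ℝ)) ≤ c :=
        Real.rpow_le_rpow_of_nonpos (by positivity) (mul_le_mul_of_nonneg_left ht.1 hν.le)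
          (by norm_num)
      exact mul_le_mul_of_nonneg_left hmono (by positivity)
    -- `L³` bound on `[t₀, T']`: `‖u(t)‖₃ ≤ b`, `b³ = ν F(A) c e₀`
    have hprod0 : 0 ≤ ν * F A * c * e₀ := by positivity
    set b : ℝ := (ν * F A * c * e₀) ^ ((3 : ℝ)⁻¹) with hb
    have hb0 : 0 ≤ b := Real.rpow_nonneg hprod0 _
    have hb3 : b ^ 3 = ν * F A * c * e₀ := by
      rw [hb]
      have h := Real.rpow_inv_natCast_pow (n := 3) hprod0 (by norm_num)
      simpa using h
    have hL3b : ∀ t ∈ Icc t₀ T', eLpNorm (u t) 3 volume ≤ ENNReal.ofReal b := fun t ht =>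
      subcubicESS_eLpNorm_three_le_ofReal (by positivity) (hMb t ht)
        (hener t ⟨ht₀0.le.trans ht.1, ht.2.trans_lt hT'2⟩) hb0 hb3.ge
    -- hence `N' ≤ max N₀ b`
    have hN'max : N' ≤ max N₀ b := by
      refine ENNReal.toReal_le_of_le_ofReal (le_max_of_le_left hN₀0) (iSup₂_le fun t ht => ?_)
      rcases le_total t t₀ with h | h
      · exact (hN₀ t ⟨ht.1, h⟩).trans (ENNReal.ofReal_le_ofReal (le_max_left _ _))
      · exact (hL3b t ⟨h, ht.2⟩).trans (ENNReal.ofReal_le_ofReal (le_max_right _ _))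
    -- ### endgame: `N' > B` is absurd
    by_contra hlt
    push Not at hlt
    have h2ν : 2 * ν < N' := lt_of_le_of_lt (le_max_left _ _) hlt
    have hνA₀ : ν * A₀ < N' := lt_of_le_of_lt ((le_max_left _ _).trans (le_max_right _ _)) hlt
    have hN₀N : N₀ < N' := lt_of_le_of_lt ((le_max_right _ _).trans (le_max_right _ _)) hlt
    have hN'pos : 0 < N' := lt_trans (by positivity) h2ν
    have h2lt : 2 < ν⁻¹ * N' := by rw [lt_inv_mul_iff₀ hν]; linarith
    have hAeq : A = ν⁻¹ * N' := max_eq_right h2lt.le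
    have hA₀A : A₀ ≤ A := by rw [hAeq, le_inv_mul_iff₀ hν]; linarith
    have hFε : F A ≤ 1 / (2 * (K + 1)) * A ^ 3 := hA₀ A hA₀A
    have hN'b : N' ≤ b := by
      rcases le_max_iff.1 hN'max with h | h
      · exact absurd h (not_le.2 hN₀N)
      · exact h
    have hcube : N' ^ 3 ≤ ν * F A * c * e₀ := (pow_le_pow_left₀ hN'0 hN'b 3).trans_eq hb3
    have hstep : ν * F A * c * e₀ ≤ (1 / (2 * (K + 1)) * K) * N' ^ 3 := by
      have h1 : ν * F A * c * e₀ = (ν * c * e₀) * F A := by ring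
      have h2 : (1 / (2 * (K + 1)) * K) * N' ^ 3 = (ν * c * e₀) * (1 / (2 * (K + 1)) * A ^ 3) := by
        rw [hAeq, hK]; ring
      rw [h1, h2]
      exact mul_le_mul_of_nonneg_left hFε (by positivity)
    have hεK : 1 / (2 * (K + 1)) * K ≤ 1 / 2 := by
      rw [div_mul_eq_mul_div, one_mul, div_le_div_iff₀ (by positivity) (by positivity)]
      nlinarith
    have hN3 : 0 < N' ^ 3 := by positivity
    have hhalf : (1 / (2 * (K + 1)) * K) * N' ^ 3 ≤ 1 / 2 * N' ^ 3 :=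
      mul_le_mul_of_nonneg_right hεK hN3.le
    linarith
  -- ### conclusion: `⨆_{t < T} ‖u(t)‖₃ ≤ B < ⊤`
  refine (iSup₂_le fun t ht => ?_).trans_lt (ENNReal.ofReal_lt_top (r := B))
  exact hkey (max t t₀) (le_max_right _ _) (max_lt ht.2 ht₀T) t ⟨ht.1, le_max_left _ _⟩

end Summit.NavierStokesRegularity.NavierStokesRegularity.Theorems

end
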